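import Summits.NavierStokesRegularity.NavierStokesRegularity.Theses.SqueezeCycle
import Literature.Analysis.FluidPDE.TypeIAncientMild
import Literature.Analysis.FluidPDE.MildSolutionProofs
import HarnessLib

/-!
# Route `SqueezeCycle`, crux `ExtremalBiaxialitySubcritical` — the small-constant regime

Helper file for item `stmt-NavierStokesRegularity-11609`
(`Summit.NavierStokesRegularity.NavierStokesRegularity.Theses.SqueezeCycle.ExtremalBiaxialitySubcritical`).

**Small Type-I constants carry no ancient dynamics.** There is a universal `ε > 0` (depending
only on the `L^∞` bound `‖B¹_s(u,u)(t)‖_∞ ≤ C_B ‖u‖²_∞ · 2√(t-s)` of the Oseen bilinear term,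
`exists_norm_oseenDuhamel_bounded_le`, KNSS 2009 §4 p. 8) such that every Type-I KNSS-mild
ancient field `u` (`Literature.Analysis.FluidPDE.IsTypeIAncientMild C u`) with `C ≤ ε` vanishes
identically on `t < 0` (`typeIAncientMild_eq_zero_of_small`). This is the ancient form of
Leray's lower bound on the blow-up rate (Leray 1934, (3.9): `‖u(t)‖_∞ ≥ ε₁ √ν (T-t)^{-1/2}`):
writing `u(t) = e^{15(-t)Δ}u(16t) - B¹_{16t}(u,u)(t)` and using the maximum principle for the
caloric part and the bilinear bound on the window `(16t, t)`, the hypothesis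
`‖u(t)‖_∞ ≤ M(-t)^{-1/2}` improves itself to `‖u(t)‖_∞ ≤ (M/4 + 8 C_B M²)(-t)^{-1/2} ≤ (M/2)(-t)^{-1/2}`
as soon as `32 C_B M ≤ 1`; iterating, `‖u(t)‖_∞ ≤ 2^{-n} C (-t)^{-1/2}` for every `n`.

Consequences for the route (all in the regime `C ≤ ε`, unconditionally):
* `squeezeClass_eq_zero_of_small` — every element of the route's inline class `𝒦_C` vanishes
  (the small-constant case of the target `SqueezeLiouville` and of the crux `MustSqueeze`);
* `extremalBiaxialitySubcritical_of_small` — the crux `ExtremalBiaxialitySubcritical` holds for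
  `C ≤ ε`, even without its maximality clause: an attained Leray-gauge middle strain eigenvalue
  `≥ m` of an element of `𝒦_C` forces `m ≤ 0 < 1/8`.

The content of the crux therefore sits entirely at Type-I constants `C > ε`.
-/

noncomputable section

open MeasureTheory Set Function Filter
open scoped RealInnerProductSpace

namespace Summit.NavierStokesRegularity.NavierStokesRegularity.Theorems

open Literature.Analysis.FluidPDE
open Summit.NavierStokesRegularity.NavierStokesRegularity.Theses

/-- A nonnegative real number below `K / 2ⁿ` for every `n` is zero. [folklore] -/
theorem eq_zero_of_forall_le_div_two_pow {a K : ℝ} (ha : 0 ≤ a) (h : ∀ n : ℕ, a ≤ K / 2 ^ n) :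
    a = 0 := by
  by_contra hne
  have ha0 : 0 < a := lt_of_le_of_ne ha (Ne.symm hne)
  rcases le_or_gt K 0 with hK | hK
  · have h0 := h 0
    rw [pow_zero, div_one] at h0
    linarith
  · obtain ⟨n, hn⟩ := exists_nat_gt (K / a)
    have h2 : (n : ℝ) < (2 : ℝ) ^ n := by exact_mod_cast Nat.lt_two_pow_self
    have hlt : K / a < (2 : ℝ) ^ n := hn.trans h2
    have hpos : (0 : ℝ) < (2 : ℝ) ^ n := pow_pos two_pos n
    have key := h n
    rw [le_div_iff₀ hpos] at key
    rw [div_lt_iff₀ ha0] at hlt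
    nlinarith

/-- **The halving step.** If a Type-I KNSS-mild ancient field obeys `‖u(t,x)‖ ≤ M/√(-t)` with
`0 ≤ M` and `32 C_B M ≤ 1` (`C_B` the constant of `exists_norm_oseenDuhamel_bounded_le`), then it
obeys `‖u(t,x)‖ ≤ (M/2)/√(-t)`: on the window `(16t, t)` the field is bounded by `M/√(-t)`, the
caloric part of `u(t) = e^{(t-s)Δ}u(s) - B¹_s(u,u)(t)`, `s = 16t`, is at most `M/√(-16t) = M/(4√(-t))`
(maximum principle) and the bilinear part at most `C_B (M/√(-t))² · 2√(15(-t)) ≤ 8 C_B M²/√(-t)`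
(KNSS 2009, §4 p. 8). [cite: KochNadirashviliSereginSverak2009, §4 p. 8, the bound ‖B(u,v)‖ ≤ C√T‖u‖‖v‖ (arXiv:0709.3599)] -/
theorem typeIAncientMild_halving {C_B : ℝ} (hCB : 0 < C_B)
    (hB : ∀ {ν : ℝ}, 0 < ν → ∀ {u v : ℝ → EuclideanSpace ℝ (Fin 3) → EuclideanSpace ℝ (Fin 3)}
      {s t M : ℝ}, s < t → 0 ≤ M →
      (∀ τ ∈ Ioo s t, ∀ y, ‖u τ y‖ ≤ M) → (∀ τ ∈ Ioo s t, ∀ y, ‖v τ y‖ ≤ M) →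
      ∀ x : EuclideanSpace ℝ (Fin 3),
        ‖oseenDuhamel ν s u v t x‖ ≤ C_B * M ^ 2 * ν ^ (-(1 / 2 : ℝ)) * (2 * Real.sqrt (t - s)))
    {C : ℝ} {u : ℝ → EuclideanSpace ℝ (Fin 3) → EuclideanSpace ℝ (Fin 3)}
    (h : IsTypeIAncientMild C u) {M : ℝ} (hM0 : 0 ≤ M) (hM : 32 * C_B * M ≤ 1)
    (hP : ∀ t < 0, ∀ x, ‖u t x‖ ≤ M / Real.sqrt (-t)) :
    ∀ t < 0, ∀ x, ‖u t x‖ ≤ (M / 2) / Real.sqrt (-t) := by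
  intro t ht x
  set s : ℝ := 16 * t with hs
  have hst : s < t := by rw [hs]; linarith
  have hs0 : s < 0 := hst.trans ht
  set r : ℝ := Real.sqrt (-t) with hr
  have hr0 : 0 < r := Real.sqrt_pos.2 (by linarith)
  have hr2 : r ^ 2 = -t := Real.sq_sqrt (by linarith)
  -- `√(-s) = 4 r` and `√(t - s) ≤ 4 r`
  have h4 : Real.sqrt 16 = (4 : ℝ) := by
    rw [show (16 : ℝ) = 4 ^ 2 by norm_num, Real.sqrt_sq (by norm_num)]
  have hsqs : Real.sqrt (-s) = 4 * r := by
    rw [hs, show -(16 * t) = 16 * (-t) by ring, Real.sqrt_mul (by norm_num), h4]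
  have hsqd : Real.sqrt (t - s) ≤ 4 * r := by
    calc Real.sqrt (t - s) ≤ Real.sqrt (16 * (-t)) :=
          Real.sqrt_le_sqrt (by rw [hs]; linarith)
      _ = 4 * r := by rw [Real.sqrt_mul (by norm_num), h4]
  -- the uniform bound on the window `(s, t)`
  have hunif : ∀ τ ∈ Ioo s t, ∀ y, ‖u τ y‖ ≤ M / r := by
    intro τ hτ y
    have hτ0 : τ < 0 := hτ.2.trans ht
    refine (hP τ hτ0 y).trans ?_
    exact div_le_div_of_nonneg_left hM0 hr0 (Real.sqrt_le_sqrt (by linarith [hτ.2]))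
  have hMr : 0 ≤ M / r := div_nonneg hM0 hr0.le
  -- the two pieces of the mild formula
  have hheat : ‖heatFlow (u s) (t - s) x‖ ≤ M / (4 * r) := by
    rw [← hsqs]
    exact norm_heatFlow_le (fun z => hP s hs0 z) _ _
  have hduh : ‖oseenDuhamel 1 s u u t x‖ ≤ 8 * C_B * M ^ 2 / r := by
    have h1 := hB one_pos hst hMr hunif hunif x
    rw [Real.one_rpow, mul_one] at h1
    refine h1.trans ?_
    have e1 : C_B * (M / r) ^ 2 * (2 * Real.sqrt (t - s)) ≤ C_B * (M / r) ^ 2 * (2 * (4 * r)) := by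
      gcongr
    refine e1.trans (le_of_eq ?_)
    field_simp
    ring
  -- assemble
  have hmild : u t x = heatFlow (u s) (t - s) x - oseenDuhamel 1 s u u t x := h.mild_eq hst ht x
  have hsmall : 8 * C_B * M ^ 2 ≤ M / 4 := by nlinarith
  calc ‖u t x‖ = ‖heatFlow (u s) (t - s) x - oseenDuhamel 1 s u u t x‖ := by rw [← hmild]
    _ ≤ ‖heatFlow (u s) (t - s) x‖ + ‖oseenDuhamel 1 s u u t x‖ := norm_sub_le _ _
    _ ≤ M / (4 * r) + 8 * C_B * M ^ 2 / r := add_le_add hheat hduh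
    _ ≤ M / (4 * r) + (M / 4) / r := by gcongr
    _ = (M / 2) / r := by field_simp; ring

/-- **Small Type-I constants force triviality** (the ancient form of Leray's lower bound on the
blow-up rate, Leray 1934 (3.9); KNSS 2009 §4 p. 8 for the bilinear bound): there is a universal
`ε > 0` such that every Type-I KNSS-mild ancient field `u` with constant `C ≤ ε` vanishes on
`t < 0`. Proof: the Type-I bound `‖u(t)‖_∞ ≤ M/√(-t)` halves itself as long as `32 C_B M ≤ 1`
(`typeIAncientMild_halving`), so `‖u(t,x)‖ ≤ 2^{-n} C/√(-t)` for all `n`. [cite: Leray1934, (3.9) (lower bound on the blow-up rate); KochNadirashviliSereginSverak2009, §4 p. 8] -/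
theorem exists_typeIAncientMild_eq_zero_of_small :
    ∃ ε : ℝ, 0 < ε ∧ ∀ (C : ℝ) (u : ℝ → EuclideanSpace ℝ (Fin 3) → EuclideanSpace ℝ (Fin 3)),
      IsTypeIAncientMild C u → C ≤ ε → ∀ t < 0, ∀ x, u t x = 0 := by
  obtain ⟨C_B, hCB, hB⟩ := exists_norm_oseenDuhamel_bounded_le (E := EuclideanSpace ℝ (Fin 3))
  refine ⟨1 / (32 * C_B), by positivity, fun C u h hC t ht x => ?_⟩
  have hC0 : 0 ≤ C := h.nonneg
  have h32 : 32 * C_B * C ≤ 1 := by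
    have := mul_le_mul_of_nonneg_left hC (by positivity : (0 : ℝ) ≤ 32 * C_B)
    rwa [mul_one_div_cancel (by positivity : (32 : ℝ) * C_B ≠ 0)] at this
  -- `‖u(t,x)‖ ≤ (C/2ⁿ)/√(-t)` for every `n`
  have hPn : ∀ n : ℕ, ∀ t < 0, ∀ x, ‖u t x‖ ≤ (C / 2 ^ n) / Real.sqrt (-t) := by
    intro n
    induction n with
    | zero =>
        intro t ht x
        rw [pow_zero, div_one]
        exact h.norm_le ht x
    | succ n ih =>
        have hMn0 : 0 ≤ C / 2 ^ n := by positivity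
        have hMn : 32 * C_B * (C / 2 ^ n) ≤ 1 := by
          have hle : C / 2 ^ n ≤ C := div_le_self hC0 (one_le_pow₀ (by norm_num))
          calc 32 * C_B * (C / 2 ^ n) ≤ 32 * C_B * C := by gcongr
            _ ≤ 1 := h32
        have key := typeIAncientMild_halving hCB (fun hν => hB hν) h hMn0 hMn ih
        intro t ht x
        have e : C / 2 ^ (n + 1) = C / 2 ^ n / 2 := by rw [pow_succ, div_div]
        rw [e]
        exact key t ht x
  -- conclude
  have hsq : 0 < Real.sqrt (-t) := Real.sqrt_pos.2 (by linarith)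
  have hle : ∀ n : ℕ, ‖u t x‖ ≤ (C / Real.sqrt (-t)) / 2 ^ n := fun n => by
    rw [div_right_comm]
    exact hPn n t ht x
  exact norm_eq_zero.1 (eq_zero_of_forall_le_div_two_pow (norm_nonneg _) hle)

/-- **The small-constant case of the route's Liouville statements**: there is a universal
`ε > 0` such that for `C ≤ ε` every element of the route's inline Type-I model class `𝒦_C`
(joint smoothness, `div u = 0`, the KNSS-mild Oseen identity written through `heatKernel`, the
Type-I rate `‖u‖ ≤ C/√(-t)`, scaled energies `≤ C`) vanishes identically on `t < 0` — the regime
`C ≤ ε` of the target `SqueezeLiouville` and of the crux `MustSqueeze`, unconditionally (the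
inline class is the tree's `IsTypeIAncientMild`, cf. `isTypeIAncientMild_iff`; the energy clause
is not used). [cite: Leray1934, (3.9); KochNadirashviliSereginSverak2009, §4 p. 8] -/
theorem squeezeClass_eq_zero_of_small :
    ∃ ε : ℝ, 0 < ε ∧ ∀ (C : ℝ) (u : ℝ → EuclideanSpace ℝ (Fin 3) → EuclideanSpace ℝ (Fin 3)),
      C ≤ ε →
      (ContDiffOn ℝ (⊤ : ℕ∞) (Function.uncurry u) (Set.Iio 0 ×ˢ Set.univ) ∧ (∀ t < 0, Literature.Analysis.FluidPDE.VectorCalculus.IsDivFree (u t)) ∧ (∀ s t : ℝ, s < t → t < 0 → ∀ x, u t x = Literature.Analysis.FluidPDE.heatFlow (u s) (t-s) x - ∫ τ in Set.Ioo s t, ∫ y, ((-(inner ℝ (x-y) (u τ y) / (2*(t-τ)) * Literature.Analysis.UnboundedOperators.heatKernel (t-τ) (x-y))) • u τ y + (∫ σ in Set.Ioi (t-τ), Literature.Analysis.UnboundedOperators.heatKernel σ (x-y) / (4*σ^2)) • (inner ℝ (x-y) (u τ y) • u τ y + inner ℝ (u τ y) (u τ y) • (x-y) + inner ℝ (x-y)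 (u τ y) • u τ y) - ((∫ σ in Set.Ioi (t-τ), Literature.Analysis.UnboundedOperators.heatKernel σ (x-y) / (8*σ^3)) * (inner ℝ (x-y) (u τ y) * inner ℝ (x-y) (u τ y))) • (x-y))) ∧ Literature.Analysis.FluidPDE.HasTypeITimeDecay C u ∧ (∀ (x₀ : EuclideanSpace ℝ (Fin 3)) (t₀ r : ℝ), t₀ ≤ 0 → 0 < r → (∀ t, t₀ - r^2 < t → t < t₀ → r⁻¹ * ∫ x in Metric.ball x₀ r, ‖u t x‖^2 ≤ C) ∧ r⁻¹ * ∫ t in Set.Ioo (t₀ - r^2) t₀, ∫ x in Metric.ball x₀ r, ‖fderiv ℝ (u t) x‖^2 ≤ C)) →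
      ∀ t < 0, ∀ x, u t x = 0 := by
  obtain ⟨ε, hε, hsmall⟩ := exists_typeIAncientMild_eq_zero_of_small
  refine ⟨ε, hε, fun C u hC hu t ht x => ?_⟩
  obtain ⟨h1, h2, h3, h4, -⟩ := hu
  have h : IsTypeIAncientMild C u := by
    rw [isTypeIAncientMild_iff]
    refine ⟨h1, h2, fun s t hst ht x => ?_, h4⟩
    rw [h3 s t hst ht x]
    rfl
  exact hsmall C u h hC t ht x

/-- **The crux `ExtremalBiaxialitySubcritical` in the small-constant regime, unconditionally and
without the maximality clause**: there is a universal `ε > 0` such that for `C ≤ ε`, if an element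
`u` of `𝒦_C` has at some `(t₀, x₀)`, `t₀ < 0`, a Leray-gauge middle strain eigenvalue `≥ m` (the
crux's Courant–Fischer clause: the quadratic form of `(−t₀)∇u(t₀,x₀)` is `≥ m|·|²` on an
orthonormal 2-frame), then `m < 1/8` — indeed `u ≡ 0` (`squeezeClass_eq_zero_of_small`), its
gradient vanishes and `m ≤ 0`. The crux's content therefore sits at `C > ε`. [cite: Leray1934, (3.9); KochNadirashviliSereginSverak2009, §4 p. 8] -/
theorem extremalBiaxialitySubcritical_of_small :
    ∃ ε : ℝ, 0 < ε ∧ ∀ (C m : ℝ) (u : ℝ → EuclideanSpace ℝ (Fin 3) → EuclideanSpace ℝ (Fin 3)) (t₀ : ℝ) (x₀ : EuclideanSpace ℝ (Fin 3)),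
      C ≤ ε → t₀ < 0 →
      (ContDiffOn ℝ (⊤ : ℕ∞) (Function.uncurry u) (Set.Iio 0 ×ˢ Set.univ) ∧ (∀ t < 0, Literature.Analysis.FluidPDE.VectorCalculus.IsDivFree (u t)) ∧ (∀ s t : ℝ, s < t → t < 0 → ∀ x, u t x = Literature.Analysis.FluidPDE.heatFlow (u s) (t-s) x - ∫ τ in Set.Ioo s t, ∫ y, ((-(inner ℝ (x-y) (u τ y) / (2*(t-τ)) * Literature.Analysis.UnboundedOperators.heatKernel (t-τ) (x-y))) • u τ y + (∫ σ in Set.Ioi (t-τ), Literature.Analysis.UnboundedOperators.heatKernel σ (x-y) / (4*σ^2)) • (inner ℝ (x-y) (u τ y) • u τ y + inner ℝ (u τ y) (u τ y) • (x-y) + inner ℝ (x-y) (u τ y) • u τ y) - ((∫ σ in Set.Ioi (t-τ), Literature.Analysis.UnboundedOperators.heatKernel σ (x-y) / (8*σ^3)) * (inner ℝ (x-y) (u τ y) * inner ℝ (x-y) (u τ y))) • (x-y))) ∧ Literature.Analysis.FluidPDE.HasTypeITimeDecay C u ∧ (∀ (x₀ : EuclideanSpace ℝ (Fin 3)) (t₀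 r : ℝ), t₀ ≤ 0 → 0 < r → (∀ t, t₀ - r^2 < t → t < t₀ → r⁻¹ * ∫ x in Metric.ball x₀ r, ‖u t x‖^2 ≤ C) ∧ r⁻¹ * ∫ t in Set.Ioo (t₀ - r^2) t₀, ∫ x in Metric.ball x₀ r, ‖fderiv ℝ (u t) x‖^2 ≤ C)) →
      (∃ v w : EuclideanSpace ℝ (Fin 3), ‖v‖ = 1 ∧ ‖w‖ = 1 ∧ inner ℝ v w = 0 ∧ ∀ α β : ℝ, m * (α^2 + β^2) ≤ (-t₀) * inner ℝ (fderiv ℝ (u t₀) x₀ (α • v + β • w)) (α • v + β • w)) →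
      m < 1 / 8 := by
  obtain ⟨ε, hε, hsmall⟩ := squeezeClass_eq_zero_of_small
  refine ⟨ε, hε, fun C m u t₀ x₀ hC ht₀ hu hGE => ?_⟩
  have hz : ∀ x, u t₀ x = 0 := fun x => hsmall C u hC hu t₀ ht₀ x
  obtain ⟨v, w, -, -, -, hαβ⟩ := hGE
  have hu0 : u t₀ = fun _ => 0 := funext hz
  have h10 := hαβ 1 0
  rw [hu0] at h10
  have hm : m ≤ 0 := by simpa using h10
  linarith

end Summit.NavierStokesRegularity.NavierStokesRegularity.Theorems

end
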